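import Mathlib
import Summits.ResolutionOfSingularities.ResolutionOfSingularities.Theorems.RadicialJungCleanModelsCleanPatchingDefs
import Literature.AlgebraicGeometry.Resolution.ProjectiveModelsCentresLocal
import Literature.AlgebraicGeometry.Resolution.ProjectiveModelsCharts
import Literature.AlgebraicGeometry.Resolution.LocalBlowup
import HarnessLib

/-!
# Route `RadicialJung`, crux `CleanModels` (stmt-ResolutionOfSingularities-15917), line `Sketch` rev 14, stub 4c
# `stub_cleanGlobalization3`: the local rings of a projective model ON AN AFFINE CHART, read in `K`

For the projective model `ProjModel.ofChart X πX hproj A j hj` of `K = Frac A` built from an affine chart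
`j : Spec A ↪ X` (`ProjectiveModelsCharts.lean`), the local ring at a chart point `j y`, read inside `K`
(`ProjModel.stalkSubring`), is the localisation `A_𝔮 ⊆ K`, `𝔮 = y` (`mem_stalkSubring_ofChart_iff`): the composite
`𝒪_{X, j y} ≅ 𝒪_{Spec A, y} = A_𝔮 → K` satisfies the characterisation `ProjModel.eq_stalkToK_of_specMap_comp` of
`stalkToK`.  Consequently it is `locAtCentre` of `A ⊆ K` at every valuation ring centred at `𝔮`
(`stalkSubring_ofChart_eq_locAtCentre`), and clean-regularity of that local ring IS clean-regularity of the chart point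
(`modelCleanRegAt_ofChart_of_cleanRegAt_locAtCentre`).  PROVED; bookkeeping for the clean resolving system of Zariski
patching for clean pairs; nothing here proves resolution in characteristic `p`.
-/

noncomputable section

set_option linter.dupNamespace false -- mandated namespace of this single-conjunct summit

open CategoryTheory AlgebraicGeometry IsLocalRing
open Literature.AlgebraicGeometry.Resolution

namespace Summit.ResolutionOfSingularities.ResolutionOfSingularities.Theorems.RadicialJung.CleanModels

section ChartStalk

variable {k K : Type} [Field k] [Field K] [Algebra k K]
  (X : Scheme.{0}) [IsIntegral X] (πX : X ⟶ Spec (.of k))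
  (hproj : Literature.AlgebraicGeometry.Motives.IsProjectiveOver (Over.mk πX))
  (A : Type) [CommRing A] [IsDomain A] [Algebra k A] [Algebra A K] [IsScalarTower k A K] [IsFractionRing A K]
  (j : Spec (.of A) ⟶ X) [IsOpenImmersion j] (hj : j ≫ πX = Spec.map (CommRingCat.ofHom (algebraMap k A)))

/-- **The local ring of `ofChart` at a chart point, read in `K`, is `A_𝔮`**: `z ∈ 𝒪_{X, j y} ⊆ K` iff `z = a / s` with
`a ∈ A`, `s ∈ A ∖ 𝔮_y`. [cite: ZariskiSamuel1960, Ch. VI §17] -/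
theorem mem_stalkSubring_ofChart_iff (y : Spec (.of A)) (z : K) :
    z ∈ (ProjModel.ofChart X πX hproj A j hj).stalkSubring (j y) ↔
      ∃ a s : A, s ∉ y.asIdeal ∧ z = algebraMap A K a / algebraMap A K s := by
  classical
  have hinj : Function.Injective (algebraMap A K) := IsFractionRing.injective A K
  have hunits : ∀ s : y.asIdeal.primeCompl, IsUnit (algebraMap A K s) := fun s =>
    isUnit_iff_ne_zero.mpr fun h => s.2 (by
      have : (s : A) = 0 := hinj (by rw [h, map_zero])
      rw [this]; exact y.asIdeal.zero_mem)
  -- the stalk of `Spec A` at `y` is `A_𝔮`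
  let St : Type := (Spec.structureSheaf A).presheaf.stalk y
  let u₀ : St →+* K := IsLocalization.lift (M := y.asIdeal.primeCompl) (S := St) hunits
  have hu₀ : ∀ a : A, u₀ (algebraMap A St a) = algebraMap A K a := fun a =>
    IsLocalization.lift_eq (M := y.asIdeal.primeCompl) hunits a
  -- `u := u₀ ∘ j^♯_y` is `stalkToK`
  let u : X.presheaf.stalk (j y) →+* K := u₀.comp (j.stalkMap y).hom
  have hu : u = (ProjModel.ofChart X πX hproj A j hj).stalkToK (j y) := by
    refine ProjModel.eq_stalkToK_of_specMap_comp (M := ProjModel.ofChart X πX hproj A j hj) (x := j y) u ?_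
    rw [ProjModel.ofChart_gen]
    change Spec.map (CommRingCat.ofHom u) ≫ X.fromSpecStalk (j y) = _
    have h1 : CommRingCat.ofHom u = j.stalkMap y ≫ CommRingCat.ofHom u₀ := rfl
    rw [h1, Spec.map_comp, Category.assoc, Scheme.SpecMap_stalkMap_fromSpecStalk, ← Category.assoc]
    congr 1
    have h2 : StructureSheaf.toStalk (CommRingCat.of A) y ≫ CommRingCat.ofHom u₀ =
        CommRingCat.ofHom (algebraMap A K) := by
      ext a
      exact hu₀ a
    rw [Spec.fromSpecStalk_eq', ← h2, Spec.map_comp]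
    rfl
  rw [ProjModel.mem_stalkSubring_iff]
  constructor
  · rintro ⟨t, rfl⟩
    rw [← hu]
    obtain ⟨⟨a, s⟩, h⟩ := IsLocalization.surj y.asIdeal.primeCompl (S := St) ((j.stalkMap y).hom t)
    refine ⟨a, s, s.2, ?_⟩
    have h' := congrArg u₀ h
    rw [map_mul, hu₀, hu₀] at h'
    change u₀ ((j.stalkMap y).hom t) = _
    rw [eq_div_iff (hunits s).ne_zero]
    exact h'
  · rintro ⟨a, s, hs, rfl⟩
    have hs' : s ∈ y.asIdeal.primeCompl := hs
    let x₀ : St := IsLocalization.mk' St a ⟨s, hs'⟩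
    obtain ⟨t, ht⟩ : ∃ t, (j.stalkMap y).hom t = x₀ :=
      ⟨(inv (j.stalkMap y)).hom x₀, by rw [← CommRingCat.comp_apply, IsIso.inv_hom_id]; rfl⟩
    refine ⟨t, ?_⟩
    rw [← hu]
    change u₀ ((j.stalkMap y).hom t) = _
    rw [ht, eq_div_iff (hunits ⟨s, hs'⟩).ne_zero]
    have hspec := IsLocalization.mk'_spec St a ⟨s, hs'⟩
    have h' := congrArg u₀ hspec
    rw [map_mul, hu₀, hu₀] at h'
    exact h'

/-- Hence, for a valuation ring `O ⊇ A` centred at `𝔮_y`, the local ring of `ofChart` at `j y` inside `K` is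
`locAtCentre (A ⊆ K) O`. [cite: ZariskiSamuel1960, Ch. VI §17] -/
theorem stalkSubring_ofChart_eq_locAtCentre (y : Spec (.of A)) (O : ValuationSubring K)
    (hAO : (algebraMap A K).range ≤ O.toSubring)
    (hcentre : ∀ a : A, O.valuation (algebraMap A K a) < 1 ↔ a ∈ y.asIdeal) :
    (ProjModel.ofChart X πX hproj A j hj).stalkSubring (j y) = locAtCentre (algebraMap A K).range O := by
  have hval : ∀ s : A, s ∉ y.asIdeal ↔ O.valuation (algebraMap A K s) = 1 := by
    intro s
    rw [← hcentre, not_lt]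
    exact ⟨fun h => le_antisymm ((O.valuation_le_one_iff _).mpr (hAO ⟨s, rfl⟩)) h, fun h => h.ge⟩
  ext z
  rw [mem_stalkSubring_ofChart_iff, mem_locAtCentre_iff]
  constructor
  · rintro ⟨a, s, hs, rfl⟩
    exact ⟨_, ⟨a, rfl⟩, _, ⟨s, rfl⟩, (hval s).mp hs, rfl⟩
  · rintro ⟨_, ⟨a, rfl⟩, _, ⟨s, rfl⟩, hv, rfl⟩
    exact ⟨a, s, (hval s).mpr hv, rfl⟩

/-- **Clean-regularity on a chart**: if `P_clean(g₀)` holds at `locAtCentre (A ⊆ K) O` for a valuation ring `O ⊇ A`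
centred at `𝔮_y`, then the chart point `j y` of `ofChart` is clean-regular. [folklore] -/
theorem modelCleanRegAt_ofChart_of_cleanRegAt_locAtCentre {p : ℕ} {g₀ : K} (y : Spec (.of A))
    (O : ValuationSubring K) (hAO : (algebraMap A K).range ≤ O.toSubring)
    (hcentre : ∀ a : A, O.valuation (algebraMap A K a) < 1 ↔ a ∈ y.asIdeal)
    (h : CleanRegAt p (locAtCentre (algebraMap A K).range O).subtype g₀) :
    ModelCleanRegAt p g₀ (ProjModel.ofChart X πX hproj A j hj) (j y) := by
  unfold ModelCleanRegAt
  rw [stalkSubring_ofChart_eq_locAtCentre X πX hproj A j hj y O hAO hcentre]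
  exact h

end ChartStalk

end Summit.ResolutionOfSingularities.ResolutionOfSingularities.Theorems.RadicialJung.CleanModels

end
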